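import Summits.QuantumFields.YangMills.Theorems.LangevinControlUVFemtoCurvatureSkewnessCRatioTransportDefs

/-!
# Route `LangevinControlUV`, crux `FemtoCurvatureSkewnessC` (stmt-QuantumFields-16205), line `ratio-transport`: vocabulary (C) —
# the engine stub split into three strictly weaker stubs over the HYPOTHESIS map

Lead `prover-line-stmt-QuantumFields-16205-c1-0` (line lead, cycle 2, 2026-08-16), companion (C) of the route-posited vocabulary
files `LangevinControlUVFemtoCurvatureSkewnessCRatioTransportDefs.lean` (p121740) and `…DefsB.lean` (p123565).  Route-posited
`def … : Prop`s only; NOTHING is asserted; none is a literature fact; none restates the crux.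

## Why (the reshape of stub E)

Skeleton v3 of the line (`Cruxes/FemtoCurvatureSkewnessC/Lines/Sketch.lean`) closes the crux modulo stub A (`Anchors`) and ONE
engine stub E = `RatioTransportEngine`:
`(∃ a, Continuous a ∧ TwoPointPackage r a) → ∃ a, IsHonestUnitMap a ∧ TwoPointPackage r a ∧ CutoffTransport r a ∧ VolumeTransport r a
∧ SeparationTransport r a` — an EXISTENTIAL over a new unit map that must RE-PROVE the two-point package (the tier-deciding crux
`FemtoCurvatureTwoPointC`, stmt-16204, in honest form) before any transport is usable, and that welds the three transports into one
un-splittable stub.  Two observations make a strictly weaker and splittable engine sufficient: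

1. The landed descent `ratioFloor_of_transports` (p124004) uses of the chain map only continuity and positivity; the volume and
   separation transports act at FIXED coupling, so they — and the ratio floor itself — only see a unit map through the femto guard
   `L · a(β) ≤ ℓ`, hence transfer from any map `a` to any map `a₀` that DOMINATES it up to a constant (`a ≤ K · a₀` eventually:
   the femto boxes of `a₀` below `ℓ/K` are femto boxes of `a` below `ℓ`).
2. So the crux's OUTPUT map can be the HYPOTHESIS map `a₀` itself (continuous by hypothesis, package by hypothesis): run the
   cutoff chain in ANY continuous positive map `a` dominated by `a₀`, the volume/separation steps in `a₀`'s boxes, read the floor in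
   `a₀`'s boxes, and get signed rigidity from `a₀`'s own package (landed `stub_signedRigidityOfRatioFloor`, p123064).  No second
   package, no honesty, no `IsHonestUnitMap`.

The three new stubs (all quantified over the hypothesis data `(G, r, a₀)`):
* `CutoffEngine`  (E_c, the RG engine proper): `∃ a`, continuous, positive, `Dominated a a₀`, with `CutoffTransport r a` (per-step,
  summable — along the engine's OWN map, e.g. the step-scaling map; NOT along `a₀`, whose admissible bounded wiggles would make a
  per-step summable transport false);
* `VolumeEngine`  (E_v): `VolumeTransport r a₀` (differential finite-size regularity at fixed coupling);
* `SeparationEngine` (E_s): `SeparationTransport r a₀` (one-position smoothness at fixed coupling).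

Kernel-checked in the companion proof file `LangevinControlUVFemtoCurvatureSkewnessCDominatedDescent.lean` (this lead):
`RatioTransportEngine → CutoffEngine ∧ VolumeEngine ∧ SeparationEngine` (the old stub implies the new three — landed ruler rigidity
`continuous_package_maps_comparable` supplies the domination), and `CutoffEngine → VolumeEngine → SeparationEngine → Anchors →
FemtoCurvatureSkewnessC` (the new three plus A close the crux BY NAME, output map `a₀`).  So skeleton v4 is a pure weakening of v3.
-/

set_option autoImplicit false

noncomputable section

namespace Summit.QuantumFields.YangMills.Cruxes.FemtoCurvatureSkewnessC.RatioTransport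

open MeasureTheory Filter Topology
open Literature.MathematicalPhysics.QuantumFieldTheory
open Summit.QuantumFields.YangMills.Theorems.FemtoCurvatureSkewness.Negative (TwoPointPackage)

/-- **Domination up to a constant, eventually**: `a β ≤ K · a₀ β` for all large `β`.  (What the landed ruler rigidity gives
between any two continuous package maps, one direction; all the descent needs to read a floor obtained along `a`-chains inside
the femto boxes of `a₀`.) -/
def Dominated (a a₀ : ℝ → ℝ) : Prop :=
  ∃ K β₃ : ℝ, 0 < K ∧ ∀ β : ℝ, β₃ ≤ β → a β ≤ K * a₀ β

/-- **Stub E_c `CutoffEngine` — the RG engine proper (sign-free, crux-sized):** for compact simple `G`, any `r` and any CONTINUOUS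
map `a₀` carrying the two-point package, SOME continuous positive map `a` dominated by `a₀` carries the per-step summable cutoff
transport of the tree-normalised skewness ratio along its own dyadic chains (`CutoffTransport r a`).  Intended witness: the
step-scaling map of the block-spin / flow RG (domination = one direction of ruler rigidity, or directly from the engine's two-point
control); content: one halving step with three gauge-invariant plaquette insertions, summable remainders. -/
def CutoffEngine : Prop :=
  ∀ (G : Type) [Group G] [TopologicalSpace G] [IsTopologicalGroup G] [CompactSpace G]
    [MeasurableSpace G] [BorelSpace G], IsCompactSimpleLieGroup G →
    ∀ (r : LatticeRep G) (a₀ : ℝ → ℝ), Continuous a₀ → TwoPointPackage r a₀ →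
      ∃ a : ℝ → ℝ, Continuous a ∧ (∀ β, 0 < a β) ∧ Dominated a a₀ ∧ CutoffTransport r a

/-- **Stub E_v `VolumeEngine` — differential finite-size regularity in the hypothesis map's femto boxes:** for compact simple `G`,
any `r` and any continuous package map `a₀`, `VolumeTransport r a₀` (at fixed coupling, shrinking the femto torus `L ↦ L' ∈ [L/2, L]`
moves the ratio by `≤ C_V (n/L')⁴ (L − L')/L'`).  Transfer-invariant under domination (`volumeTransport_of_dominated`), so this
∀-form over package maps is the ∃-form for one continuous package map modulo the landed ruler rigidity. -/
def VolumeEngine : Prop :=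
  ∀ (G : Type) [Group G] [TopologicalSpace G] [IsTopologicalGroup G] [CompactSpace G]
    [MeasurableSpace G] [BorelSpace G], IsCompactSimpleLieGroup G →
    ∀ (r : LatticeRep G) (a₀ : ℝ → ℝ), Continuous a₀ → TwoPointPackage r a₀ → VolumeTransport r a₀

/-- **Stub E_s `SeparationEngine` — one-position smoothness in the hypothesis map's femto boxes:** for compact simple `G`, any `r`
and any continuous package map `a₀`, `SeparationTransport r a₀` (at fixed `(L, β)` the ratio is `C_S/n`-Lipschitz in the
separation).  Transfer-invariant under domination (`separationTransport_of_dominated`). -/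
def SeparationEngine : Prop :=
  ∀ (G : Type) [Group G] [TopologicalSpace G] [IsTopologicalGroup G] [CompactSpace G]
    [MeasurableSpace G] [BorelSpace G], IsCompactSimpleLieGroup G →
    ∀ (r : LatticeRep G) (a₀ : ℝ → ℝ), Continuous a₀ → TwoPointPackage r a₀ → SeparationTransport r a₀

/-! ## Registered stub signatures of skeleton v4 (`Cruxes/FemtoCurvatureSkewnessC/Lines/Sketch.lean`)

Abbreviations only (`theorem stub_<name> : Sig.stub_<name>` in the skeleton); `Sig.stub_anchors` is unchanged (file `…Defs.lean`). -/

/-- Registered signature of stub E_c. -/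
def Sig.stub_cutoffEngine : Prop := CutoffEngine

/-- Registered signature of stub E_v. -/
def Sig.stub_volumeEngine : Prop := VolumeEngine

/-- Registered signature of stub E_s. -/
def Sig.stub_separationEngine : Prop := SeparationEngine

end Summit.QuantumFields.YangMills.Cruxes.FemtoCurvatureSkewnessC.RatioTransport

end
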